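import Literature.NumberTheory.Rogawski1990.ArchInnerTransferCompatible      -- ★ p826620 (T6a): letter N2 `ArchInnerTransferCompatible` [Shelstad1979 Thm. 4.1 + CD]
import Literature.NumberTheory.Rogawski1990.ArchEndoscopicTransferCompatible  -- ★ p826679 (T6a): letter N3 `ArchEndoscopicTransferCompatible` [Shelstad1982∕83 + CD]
import Literature.NumberTheory.Rogawski1990.ArchExplicitTransferFactor        -- ★ p826337 (T6b): N1a `archExplicitTransferFactor` = print's `Δ″_∞` [§4.9 p. 55; §14.6 p. 242]
import Literature.NumberTheory.Rogawski1990.ArchExplicitTransferFactorNondegenerate  -- ★ p827632 (B-p12 (g25)): (N2∞) closer `isArchNondegenerate_archExplicitTransferFactor`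
import Literature.NumberTheory.Rogawski1990.ArchCompatibleFamiliesExist   -- ★ p827798 (B-p17 (g20)): (M) closer `exists_archCompatibleFamilies`
import Literature.NumberTheory.Automorphic.QuadraticHeckeCharacterCM          -- ★ `quadraticHeckeCharCM` = `ω_{L∕L⁺}` (the μ-guard of print's endoscopic datum, §4.6–4.8)
import Literature.NumberTheory.Automorphic.LocalStableOrbitalFinite            -- ★ `stableOrbitalIntegralRel_smul_fun` (ray transport)
import HarnessLib

/-!
# LINE «ArchTransfersExistCanonical» (#77) PAY-DOWN — skeleton DRAFT (typer seat T6a, s554 format; the director registers∕cuts)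

Cell `hodgecm-mathlib`, F0∕P3a, crux H413 (`stmt-HodgeConjecture-24833`), fan-B row III-23 (#77) `Rogawski1990.ArchTransfersExistCanonical` (★ p808152,
`Literature/NumberTheory/Rogawski1990/TransferFactsCanonical.lean` :541; the ENGINE T1 head's antecedent `hAT`; its ED. 2 `…CanonicalSingular` = `hAT₄` projects onto
it by `.canonical`) [Rogawski1990 §14.2 (14.2.1), §14.3, Prop. 4.9.1 (a), §1.7; Shelstad1979; Shelstad1983; ClozelDelorme1984].  Typer T6a (director
PLAN-THROUGHPUT-P2-P5.g16 §4 topic T6); statement tree `F0/P3a/T6a-TREE.md`.  HONEST LABEL: HC_CM is proved only modulo the printed citations (named inputs remaining 2)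
until rung 0 closes; this skeleton discharges NOTHING until its stubs close, and even then the letters N2, N3 (Shelstad's real transfer theorems + Clozel–Delorme)
REMAIN cited — the row #77 is REPLACED by {N2, N3} (thinner: the measure convention and the admissibility clauses leave the books) + the `T`-clause ND.

THE CUT (2 `sorry` stubs + 2 letters BY NAME + the kernel-checked composition `archTransfersExistCanonical_of_stubs`):
* `stub_archCompatibleFamilies_exists` (M) — PAYABLE-NOW (L; pure measure theory, no representation theory): for Haar `ν′, ν, νH` and anisotropic `H′` there EXIST
  Weil-form families `m′ = dν′∕dt′`, `m = dν∕dt`, `mH = dνH∕dtH` whose centraliser (torus) measures are transported along ★ O8 `UnitaryGroup.archStableCentralizerEquiv`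
  (inside `G′_∞`, inside `G_∞`, across the inner twist) and along ★ `endoEmbArchCentralizer` (`ι_∞ : H_∞ → G_∞`) — ★ predicates `ArchCompatibleFamiliesG ∕ H`
  (p826202 ∕ ED. 2 p826563).  ROAD: choose ONE Haar measure `t_γ` on `Z(γ)` for a representative `γ` of each regular stable class of `G_∞` and transport it to the stable class
  (inside `G_∞` by (C), to `G′_∞` by (C′G), to `H_∞` by (C_H) composed with (C)); well-definedness = «transport around a cycle of the canonical equivalences is the
  identity on Haar measures» (all the equivalences are restrictions of `(L ⊗ ℝ)`-algebra isomorphisms `(L ⊗ ℝ)[γ₁] ≅ (L ⊗ ℝ)[γ₂]`, i.e. of isomorphisms of real tori,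
  hence Haar-measure preserving up to the modulus `1`); Haar measures on the closed subgroups `Z(γ)` exist (Mathlib `MeasureTheory.Measure.haarMeasure`);
  templates at the finite places: ★ `OrbitalMeasureQuotientOfPoint[HaarChange]`, ★ `UnitaryGroupPatchedFamiliesTransport`, ★ `UnitaryGroupOfLocalCovolumeStableKit`.
* `stub_archTransferFactor_nondegenerate` (ND) — HYPOTHESIS on the parameter `T` today; PAYABLE-NOW (S∕M) the hour node N1 (the explicit archimedean factor
  `Δ_{G∕H,∞} = ∏_v τ_v · D_{G∕H,v}` of §4.9 p. 55 ∕ `Δ″_v` of §14.4 p. 236, a DEFINITION with body) lands and the line is instantiated at `T := rogawskiArchTransferFactor …`: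
  `|Δ_{G∕H}(γ)| = D_G(γ) D_H(γ)⁻¹ ≠ 0` on the `G`-regular set.
* `stub_archInnerTransferCompatible` (N2) — LETTER, closed statement, consumed BY NAME: ★ p826620 `ArchInnerTransferCompatible L H′ ν′ ν` [Rogawski1990 §14.2 p. 233
  «the existence of `f_v` follows from results of Shelstad ([S₁])»; Shelstad1979 Thm. 4.1 p. 21; ClozelDelorme1984 Thm. 1 via ArthurClozel1989 Ch. 1 Lemma 7.3 (i)].
* (N3) — LETTER about `T`, HYPOTHESIS `hN3 : ArchEndoscopicTransferCompatible L H′ T ν′ ν νH` [Rogawski1990 §14.3 p. 234, Prop. 4.9.1 (a) p. 55; Shelstad1982∕1983;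
  ClozelDelorme1984]; becomes a closed stub `… (rogawskiArchTransferFactor …) …` with N1.
IN-HOUSE ROAD for N2∕N3 (tree layer 2, NOT payable today — vocabulary absent): Harish-Chandra Schwartz space, tempered dual and global characters as `L¹_loc` functions,
Weyl integration formula, standard modules `π_{δ,ν}` of `U(2,1)`, `U(1,1) × U(1)` and their `C_c^∞`-traces, Paley–Wiener space `PW(𝔞*_ℂ)^W`; then [Shelstad1979
Thm. 4.1∕4.7∕Lemma 5.3∕Thm. 6.3], [Shelstad1982], [ClozelDelorme1984 Thm. 1], [ArthurClozel1989 Lemma 7.3 (i)] as theorems.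

DEF∕PROOF discipline: theorems only, `sorry` ONLY inside the two LETTER stubs N8 `stub_archInnerTransferCompatible` and N9@Δ″ `stub_archEndoscopicTransferCompatible_explicit`
(v5; up to v4 also inside the then-payable stubs (M) `stub_archCompatibleFamilies_exists` and (N2∞) `stub_explicitFactor_nondegenerate`, now CLOSED BY NAME);
no `def` except the closed registry form of §3; no instance, no notation; `--supports stmt-HodgeConjecture-24833`.  NOT FILED by the typer (director registers).
CHECK: by-paste leg over the three (then pending) Literature leaves `F0/P3a/typ-T6a/PASTE-T6a-lines.lean` rc 0, sorries 2; v2∕v3 BY IMPORT rc 0, sorries 4 (see bus lines).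

v2 (same session, after LEAD DESK WORD T6b-1 (2) «REGISTRAR RULE: every registered stub TRUE AS TYPED; (i) Haar binders; (ii) `T` ON PRINT'S RAY»): §1 keeps (M) and
(N2); §1b adds the stubs AT PRINT'S FACTOR `Δ″_∞ = archExplicitTransferFactor L H′ μ hl hr` (twin's ★ N1a) under the μ-GUARD `μ|_{𝕀_{L⁺}} = ω_{L∕L⁺}` (★
`quadraticHeckeCharCM`; without it the instantiated N3 would be false as typed): `stub_explicitFactor_nondegenerate` (N2∞, PAYABLE after N1a-r) and
`stub_archEndoscopicTransferCompatible_explicit` (N3 = twin's N9 at `Δ″_∞`, LETTER, closed); §1c PROVES the RAY TRANSPORT (R): non-degeneracy and the N3-letter pass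
from `T₀` to any `T` with `T.Δ = c·T₀.Δ`, `c ≠ 0` (`mul_ne_zero`; `c • a^H` via ★ `stableOrbitalIntegralRel_smul_fun` + `mul_finsum`, ★ `archSmooth` a submodule);
§2b composes the RAY HEAD `archTransfersExistCanonical_holds_ray … (hT : ∀ a b, T.Δ a b = c * Δ″_∞.Δ a b) (hc : c ≠ 0) : ArchTransfersExistCanonical L H′ T ν′ ν νH`
from the four stubs — the frame the junction stub of T6-L2 (`Lines-draft/T6b_…`, line of record) can call BY NAME.

v3 (LEAD DESK WORDS T6-2 (B) ∕ T6-4 «=» on v2 as the nested line T6-L1): namespace RENAMED to the registered-module convention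
`…Cruxes.H413.F0P3aArchTransfersCanonicalPaydown` (module `Cruxes/H413/Lines/F0_P3a_ArchTransfersCanonicalPaydown.lean`), so that T6-L2's junction reads
`stub_archTransfersExistCanonical := F0P3aArchTransfersCanonicalPaydown.archTransfersExistCanonical_holds_ray …` token for token; all four imports are ★
(p826563, p826620, p826679, p826337); statements and proofs byte-identical to v2.

v4 (ref1 (g6) R1-211): `include hμu hμω in` ×2 — the μ-guard enters the elaborated types of (N3@Δ″) and the ray head.

v5 (B-p17 (g20), LEAD T6-8∕T6-9): (M) := ★ p827798 `exists_archCompatibleFamilies`, (N2∞) := ★ p827632 `isArchNondegenerate_archExplicitTransferFactor` — `sorry` ONLY inside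
the two LETTER stubs N8 `stub_archInnerTransferCompatible` and N9@Δ″ `stub_archEndoscopicTransferCompatible_explicit` (by-import leg rc 0, warnings 2 = sorries 2;
`archTransfersExistCanonical_of_stubs` TRIO, `archTransfersExistCanonical_holds_ray` TRIO + sorryAx from N9); lint-clean: `_hherm` in (M) (idle hypothesis), `omit [...] in`
of the six idle measurable∕Borel section binders on (N2∞); two imports added (★ `ArchExplicitTransferFactorNondegenerate`, ★ `ArchCompatibleFamiliesExist`).
-/

set_option autoImplicit false
set_option linter.dupNamespace false

noncomputable section

open NumberField IsDedekindDomain MeasureTheory Measure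
open Literature.NumberTheory.Rogawski1990 Literature.NumberTheory.Automorphic Literature.NumberTheory.GaloisRepresentations
open Literature.AlgebraicGeometry.ShimuraVarieties (unitaryGroup hermForm)
-- `Classical`: the place subtypes indexing `mixedSpace L` are `Fintype` classically (`NormedCommRing (mixedSpace L)`), as in ★ `ArchimedeanTransfer`
open scoped Matrix MatrixGroups Classical

namespace Summit.HodgeConjecture.HodgeConjecture.Cruxes.H413.F0P3aArchTransfersCanonicalPaydown

/-! ## §0 (v2) Ray transport of non-degeneracy (measure-free) -/

/-- **(R-nd) Non-degeneracy along the ray**: `T.Δ = c · T₀.Δ` with `c ≠ 0` and `T₀` non-degenerate ⇒ `T` non-degenerate. [cite: Rogawski1990, §14.6 p. 242] -/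
theorem isArchNondegenerate_of_ray {L : Type} [Field L] [NumberField L] [IsCMField L] {H' : Matrix (Fin 3) (Fin 3) L}
    {T T₀ : ArchTransferFactor L H'} {c : ℂ} (hc : c ≠ 0) (hT : ∀ a b, T.Δ a b = c * T₀.Δ a b)
    (h₀ : IsArchNondegenerate L H' T₀) : IsArchNondegenerate L H' T := by
  rw [isArchNondegenerate_iff] at h₀ ⊢
  intro γH γ hp hreg
  rw [hT]
  exact mul_ne_zero hc (h₀ γH γ hp hreg)


variable (L : Type) [Field L] [NumberField L] [IsCMField L] (H' : Matrix (Fin 3) (Fin 3) L) (T : ArchTransferFactor L H')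
    [MeasurableSpace (UnitaryGroup.arch (↥(maximalRealSubfield L)) L (IsCMField.complexConj L) 3 H')]
    [BorelSpace (UnitaryGroup.arch (↥(maximalRealSubfield L)) L (IsCMField.complexConj L) 3 H')]
    [MeasurableSpace (UnitaryGroup.arch (↥(maximalRealSubfield L)) L (IsCMField.complexConj L) 3
      (Matrix.of fun i j : Fin 3 => if i.val + j.val + 1 = 3 then (1 : L) else 0))]
    [BorelSpace (UnitaryGroup.arch (↥(maximalRealSubfield L)) L (IsCMField.complexConj L) 3
      (Matrix.of fun i j : Fin 3 => if i.val + j.val + 1 = 3 then (1 : L) else 0))]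
    [MeasurableSpace (UnitaryGroup.arch (↥(maximalRealSubfield L)) L (IsCMField.complexConj L) 2
            (Matrix.of fun i j : Fin 2 => if i.val + j.val + 1 = 2 then (1 : L) else 0) ×
          UnitaryGroup.arch (↥(maximalRealSubfield L)) L (IsCMField.complexConj L) 1
            (Matrix.of fun i j : Fin 1 => if i.val + j.val + 1 = 1 then (1 : L) else 0))]
    [BorelSpace (UnitaryGroup.arch (↥(maximalRealSubfield L)) L (IsCMField.complexConj L) 2
            (Matrix.of fun i j : Fin 2 => if i.val + j.val + 1 = 2 then (1 : L) else 0) ×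
          UnitaryGroup.arch (↥(maximalRealSubfield L)) L (IsCMField.complexConj L) 1
            (Matrix.of fun i j : Fin 1 => if i.val + j.val + 1 = 1 then (1 : L) else 0))]
    (ν' : Measure (UnitaryGroup.arch (↥(maximalRealSubfield L)) L (IsCMField.complexConj L) 3 H'))
    (ν : Measure (UnitaryGroup.arch (↥(maximalRealSubfield L)) L (IsCMField.complexConj L) 3
      (Matrix.of fun i j : Fin 3 => if i.val + j.val + 1 = 3 then (1 : L) else 0)))
    (νH : Measure (UnitaryGroup.arch (↥(maximalRealSubfield L)) L (IsCMField.complexConj L) 2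
            (Matrix.of fun i j : Fin 2 => if i.val + j.val + 1 = 2 then (1 : L) else 0) ×
          UnitaryGroup.arch (↥(maximalRealSubfield L)) L (IsCMField.complexConj L) 1
            (Matrix.of fun i j : Fin 1 => if i.val + j.val + 1 = 1 then (1 : L) else 0)))
    [ν'.IsHaarMeasure] [ν'.IsMulRightInvariant] [ν.IsHaarMeasure] [ν.IsMulRightInvariant] [νH.IsHaarMeasure] [νH.IsMulRightInvariant]

/-! ## §1 The stubs -/

/-- **STUB (M) — PAYABLE-NOW (L): a Weil-form system of orbital measures with transport-compatible centraliser measures EXISTS** on `G′_∞`, `G_∞`, `H_∞` for the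
given Haar measures (print's measure convention is satisfiable: [Rogawski1990 §1.7 p. 6 «compatible measures»; Shelstad1979 §4 p. 20 «the pair `dt′, ψ_x` defines a
measure `dt` on `T`, independently of the choice of `x`»]).  Pure measure theory over ★ O8 `archStableCentralizerEquiv`, ★ `endoEmbArchCentralizer`, Mathlib Haar
measure on the closed tori `Z(γ)`. [cite: Rogawski1990, §1.7 p. 6; §4.3 (4.3.1) p. 43] [cite: Shelstad1979, §4 p. 20] [cite: LanglandsShelstad1987, §1.3–1.4] -/
theorem stub_archCompatibleFamilies_exists (_hherm : (H'.map (cmConjRingHom L)).transpose = H')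
    (hanis : ∀ x : Fin 3 → L, hermForm (cmConjRingHom L) H' x x = 0 → x = 0) :
    letI : ∀ γ : UnitaryGroup.arch (↥(maximalRealSubfield L)) L (IsCMField.complexConj L) 3 H',
        MeasurableSpace (UnitaryGroup.arch (↥(maximalRealSubfield L)) L (IsCMField.complexConj L) 3 H' ⧸
          Subgroup.centralizer ({γ} : Set (UnitaryGroup.arch (↥(maximalRealSubfield L)) L (IsCMField.complexConj L) 3 H'))) :=
      fun _ => borel _
    haveI : ∀ γ : UnitaryGroup.arch (↥(maximalRealSubfield L)) L (IsCMField.complexConj L) 3 H',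
        BorelSpace (UnitaryGroup.arch (↥(maximalRealSubfield L)) L (IsCMField.complexConj L) 3 H' ⧸
          Subgroup.centralizer ({γ} : Set (UnitaryGroup.arch (↥(maximalRealSubfield L)) L (IsCMField.complexConj L) 3 H'))) :=
      fun _ => ⟨rfl⟩
    letI : ∀ γ : UnitaryGroup.arch (↥(maximalRealSubfield L)) L (IsCMField.complexConj L) 3
          (Matrix.of fun i j : Fin 3 => if i.val + j.val + 1 = 3 then (1 : L) else 0),
        MeasurableSpace (UnitaryGroup.arch (↥(maximalRealSubfield L)) L (IsCMField.complexConj L) 3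
            (Matrix.of fun i j : Fin 3 => if i.val + j.val + 1 = 3 then (1 : L) else 0) ⧸
          Subgroup.centralizer ({γ} : Set (UnitaryGroup.arch (↥(maximalRealSubfield L)) L (IsCMField.complexConj L) 3
            (Matrix.of fun i j : Fin 3 => if i.val + j.val + 1 = 3 then (1 : L) else 0)))) :=
      fun _ => borel _
    haveI : ∀ γ : UnitaryGroup.arch (↥(maximalRealSubfield L)) L (IsCMField.complexConj L) 3
          (Matrix.of fun i j : Fin 3 => if i.val + j.val + 1 = 3 then (1 : L) else 0),
        BorelSpace (UnitaryGroup.arch (↥(maximalRealSubfield L)) L (IsCMField.complexConj L) 3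
            (Matrix.of fun i j : Fin 3 => if i.val + j.val + 1 = 3 then (1 : L) else 0) ⧸
          Subgroup.centralizer ({γ} : Set (UnitaryGroup.arch (↥(maximalRealSubfield L)) L (IsCMField.complexConj L) 3
            (Matrix.of fun i j : Fin 3 => if i.val + j.val + 1 = 3 then (1 : L) else 0)))) :=
      fun _ => ⟨rfl⟩
    letI : ∀ a : (UnitaryGroup.arch (↥(maximalRealSubfield L)) L (IsCMField.complexConj L) 2
          (Matrix.of fun i j : Fin 2 => if i.val + j.val + 1 = 2 then (1 : L) else 0) ×
        UnitaryGroup.arch (↥(maximalRealSubfield L)) L (IsCMField.complexConj L) 1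
          (Matrix.of fun i j : Fin 1 => if i.val + j.val + 1 = 1 then (1 : L) else 0)),
        MeasurableSpace ((UnitaryGroup.arch (↥(maximalRealSubfield L)) L (IsCMField.complexConj L) 2
            (Matrix.of fun i j : Fin 2 => if i.val + j.val + 1 = 2 then (1 : L) else 0) ×
          UnitaryGroup.arch (↥(maximalRealSubfield L)) L (IsCMField.complexConj L) 1
            (Matrix.of fun i j : Fin 1 => if i.val + j.val + 1 = 1 then (1 : L) else 0)) ⧸
          Subgroup.centralizer ({a} : Set (UnitaryGroup.arch (↥(maximalRealSubfield L)) L (IsCMField.complexConj L) 2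
            (Matrix.of fun i j : Fin 2 => if i.val + j.val + 1 = 2 then (1 : L) else 0) ×
          UnitaryGroup.arch (↥(maximalRealSubfield L)) L (IsCMField.complexConj L) 1
            (Matrix.of fun i j : Fin 1 => if i.val + j.val + 1 = 1 then (1 : L) else 0)))) :=
      fun _ => borel _
    haveI : ∀ a : (UnitaryGroup.arch (↥(maximalRealSubfield L)) L (IsCMField.complexConj L) 2
          (Matrix.of fun i j : Fin 2 => if i.val + j.val + 1 = 2 then (1 : L) else 0) ×
        UnitaryGroup.arch (↥(maximalRealSubfield L)) L (IsCMField.complexConj L) 1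
          (Matrix.of fun i j : Fin 1 => if i.val + j.val + 1 = 1 then (1 : L) else 0)),
        BorelSpace ((UnitaryGroup.arch (↥(maximalRealSubfield L)) L (IsCMField.complexConj L) 2
            (Matrix.of fun i j : Fin 2 => if i.val + j.val + 1 = 2 then (1 : L) else 0) ×
          UnitaryGroup.arch (↥(maximalRealSubfield L)) L (IsCMField.complexConj L) 1
            (Matrix.of fun i j : Fin 1 => if i.val + j.val + 1 = 1 then (1 : L) else 0)) ⧸
          Subgroup.centralizer ({a} : Set (UnitaryGroup.arch (↥(maximalRealSubfield L)) L (IsCMField.complexConj L) 2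
            (Matrix.of fun i j : Fin 2 => if i.val + j.val + 1 = 2 then (1 : L) else 0) ×
          UnitaryGroup.arch (↥(maximalRealSubfield L)) L (IsCMField.complexConj L) 1
            (Matrix.of fun i j : Fin 1 => if i.val + j.val + 1 = 1 then (1 : L) else 0)))) :=
      fun _ => ⟨rfl⟩
    ∃ (m' : OrbitalMeasureFamily (UnitaryGroup.arch (↥(maximalRealSubfield L)) L (IsCMField.complexConj L) 3 H'))
      (m : OrbitalMeasureFamily (UnitaryGroup.arch (↥(maximalRealSubfield L)) L (IsCMField.complexConj L) 3
        (Matrix.of fun i j : Fin 3 => if i.val + j.val + 1 = 3 then (1 : L) else 0)))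
      (mH : OrbitalMeasureFamily (UnitaryGroup.arch (↥(maximalRealSubfield L)) L (IsCMField.complexConj L) 2
          (Matrix.of fun i j : Fin 2 => if i.val + j.val + 1 = 2 then (1 : L) else 0) ×
        UnitaryGroup.arch (↥(maximalRealSubfield L)) L (IsCMField.complexConj L) 1
          (Matrix.of fun i j : Fin 1 => if i.val + j.val + 1 = 1 then (1 : L) else 0)))
      (t' : ∀ γ' : UnitaryGroup.arch (↥(maximalRealSubfield L)) L (IsCMField.complexConj L) 3 H',
        Measure (Subgroup.centralizer ({γ'} : Set (UnitaryGroup.arch (↥(maximalRealSubfield L)) L (IsCMField.complexConj L) 3 H'))))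
      (t : ∀ γ : UnitaryGroup.arch (↥(maximalRealSubfield L)) L (IsCMField.complexConj L) 3
          (Matrix.of fun i j : Fin 3 => if i.val + j.val + 1 = 3 then (1 : L) else 0),
        Measure (Subgroup.centralizer ({γ} : Set (UnitaryGroup.arch (↥(maximalRealSubfield L)) L (IsCMField.complexConj L) 3
          (Matrix.of fun i j : Fin 3 => if i.val + j.val + 1 = 3 then (1 : L) else 0)))))
      (tH : ∀ γH : UnitaryGroup.arch (↥(maximalRealSubfield L)) L (IsCMField.complexConj L) 2
            (Matrix.of fun i j : Fin 2 => if i.val + j.val + 1 = 2 then (1 : L) else 0) ×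
          UnitaryGroup.arch (↥(maximalRealSubfield L)) L (IsCMField.complexConj L) 1
            (Matrix.of fun i j : Fin 1 => if i.val + j.val + 1 = 1 then (1 : L) else 0),
        Measure (Subgroup.centralizer ({γH} : Set (UnitaryGroup.arch (↥(maximalRealSubfield L)) L (IsCMField.complexConj L) 2
            (Matrix.of fun i j : Fin 2 => if i.val + j.val + 1 = 2 then (1 : L) else 0) ×
          UnitaryGroup.arch (↥(maximalRealSubfield L)) L (IsCMField.complexConj L) 1
            (Matrix.of fun i j : Fin 1 => if i.val + j.val + 1 = 1 then (1 : L) else 0))))),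
      ArchCompatibleFamiliesG L H' ν' ν hanis m' m t' t ∧ ArchCompatibleFamiliesH L νH mH tH t :=
  exists_archCompatibleFamilies L H' ν' ν νH hanis

/-- **STUB (N2) — LETTER, CITED (no prover until tree layer 2 exists): the archimedean inner-form transfer exists on `C_c^∞` for every compatible Weil-form system**
= ★ p826620 `ArchInnerTransferCompatible L H′ ν′ ν` BY NAME. [cite: Rogawski1990, §14.2 (14.2.1) pp. 232–233] [cite: Shelstad1979, Thm. 4.1 p. 21]
[cite: ClozelDelorme1984, Thm. 1] [cite: ArthurClozel1989, Ch. 1 §7 Lemma 7.3 (i)] -/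
theorem stub_archInnerTransferCompatible : ArchInnerTransferCompatible L H' ν' ν := by
  sorry

/-! ## §2 The kernel-checked composition: (M) + (ND) + N2 + N3 ⟹ ★ #77 BY NAME (no `sorry`) -/

variable {L H' T ν' ν νH}

/-- **`ArchTransfersExistCanonical` FROM THE STUB TEXTS** (composition; `sorry`-free): open the compatible system of (M); conjuncts (i)(ii)(iii) are the Haar riders of
★ `ArchCompatibleFamilies` (ED. 2 p826563); (iv) = (ND); (v) = N2 at the system; (vi) = N3 at the system; (W′)(W)(W_H)(C′)(C)(C′G)(C_H) = the system's own clauses.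
[cite: Rogawski1990, §14.2 (14.2.1) pp. 232–233; §14.3 pp. 233–234; §4.9 Prop. 4.9.1 (a) p. 55; §1.7 p. 6] -/
theorem archTransfersExistCanonical_of_stubs
    (hM : ∀ (hherm : (H'.map (cmConjRingHom L)).transpose = H') (hanis : ∀ x : Fin 3 → L, hermForm (cmConjRingHom L) H' x x = 0 → x = 0),
      letI : ∀ γ : UnitaryGroup.arch (↥(maximalRealSubfield L)) L (IsCMField.complexConj L) 3 H',
          MeasurableSpace (UnitaryGroup.arch (↥(maximalRealSubfield L)) L (IsCMField.complexConj L) 3 H' ⧸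
            Subgroup.centralizer ({γ} : Set (UnitaryGroup.arch (↥(maximalRealSubfield L)) L (IsCMField.complexConj L) 3 H'))) :=
        fun _ => borel _
      haveI : ∀ γ : UnitaryGroup.arch (↥(maximalRealSubfield L)) L (IsCMField.complexConj L) 3 H',
          BorelSpace (UnitaryGroup.arch (↥(maximalRealSubfield L)) L (IsCMField.complexConj L) 3 H' ⧸
            Subgroup.centralizer ({γ} : Set (UnitaryGroup.arch (↥(maximalRealSubfield L)) L (IsCMField.complexConj L) 3 H'))) :=
        fun _ => ⟨rfl⟩
      letI : ∀ γ : UnitaryGroup.arch (↥(maximalRealSubfield L)) L (IsCMField.complexConj L) 3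
            (Matrix.of fun i j : Fin 3 => if i.val + j.val + 1 = 3 then (1 : L) else 0),
          MeasurableSpace (UnitaryGroup.arch (↥(maximalRealSubfield L)) L (IsCMField.complexConj L) 3
              (Matrix.of fun i j : Fin 3 => if i.val + j.val + 1 = 3 then (1 : L) else 0) ⧸
            Subgroup.centralizer ({γ} : Set (UnitaryGroup.arch (↥(maximalRealSubfield L)) L (IsCMField.complexConj L) 3
              (Matrix.of fun i j : Fin 3 => if i.val + j.val + 1 = 3 then (1 : L) else 0)))) :=
        fun _ => borel _
      haveI : ∀ γ : UnitaryGroup.arch (↥(maximalRealSubfield L)) L (IsCMField.complexConj L) 3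
            (Matrix.of fun i j : Fin 3 => if i.val + j.val + 1 = 3 then (1 : L) else 0),
          BorelSpace (UnitaryGroup.arch (↥(maximalRealSubfield L)) L (IsCMField.complexConj L) 3
              (Matrix.of fun i j : Fin 3 => if i.val + j.val + 1 = 3 then (1 : L) else 0) ⧸
            Subgroup.centralizer ({γ} : Set (UnitaryGroup.arch (↥(maximalRealSubfield L)) L (IsCMField.complexConj L) 3
              (Matrix.of fun i j : Fin 3 => if i.val + j.val + 1 = 3 then (1 : L) else 0)))) :=
        fun _ => ⟨rfl⟩
      letI : ∀ a : (UnitaryGroup.arch (↥(maximalRealSubfield L)) L (IsCMField.complexConj L) 2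
            (Matrix.of fun i j : Fin 2 => if i.val + j.val + 1 = 2 then (1 : L) else 0) ×
          UnitaryGroup.arch (↥(maximalRealSubfield L)) L (IsCMField.complexConj L) 1
            (Matrix.of fun i j : Fin 1 => if i.val + j.val + 1 = 1 then (1 : L) else 0)),
          MeasurableSpace ((UnitaryGroup.arch (↥(maximalRealSubfield L)) L (IsCMField.complexConj L) 2
              (Matrix.of fun i j : Fin 2 => if i.val + j.val + 1 = 2 then (1 : L) else 0) ×
            UnitaryGroup.arch (↥(maximalRealSubfield L)) L (IsCMField.complexConj L) 1
              (Matrix.of fun i j : Fin 1 => if i.val + j.val + 1 = 1 then (1 : L) else 0)) ⧸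
            Subgroup.centralizer ({a} : Set (UnitaryGroup.arch (↥(maximalRealSubfield L)) L (IsCMField.complexConj L) 2
              (Matrix.of fun i j : Fin 2 => if i.val + j.val + 1 = 2 then (1 : L) else 0) ×
            UnitaryGroup.arch (↥(maximalRealSubfield L)) L (IsCMField.complexConj L) 1
              (Matrix.of fun i j : Fin 1 => if i.val + j.val + 1 = 1 then (1 : L) else 0)))) :=
        fun _ => borel _
      haveI : ∀ a : (UnitaryGroup.arch (↥(maximalRealSubfield L)) L (IsCMField.complexConj L) 2
            (Matrix.of fun i j : Fin 2 => if i.val + j.val + 1 = 2 then (1 : L) else 0) ×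
          UnitaryGroup.arch (↥(maximalRealSubfield L)) L (IsCMField.complexConj L) 1
            (Matrix.of fun i j : Fin 1 => if i.val + j.val + 1 = 1 then (1 : L) else 0)),
          BorelSpace ((UnitaryGroup.arch (↥(maximalRealSubfield L)) L (IsCMField.complexConj L) 2
              (Matrix.of fun i j : Fin 2 => if i.val + j.val + 1 = 2 then (1 : L) else 0) ×
            UnitaryGroup.arch (↥(maximalRealSubfield L)) L (IsCMField.complexConj L) 1
              (Matrix.of fun i j : Fin 1 => if i.val + j.val + 1 = 1 then (1 : L) else 0)) ⧸
            Subgroup.centralizer ({a} : Set (UnitaryGroup.arch (↥(maximalRealSubfield L)) L (IsCMField.complexConj L) 2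
              (Matrix.of fun i j : Fin 2 => if i.val + j.val + 1 = 2 then (1 : L) else 0) ×
            UnitaryGroup.arch (↥(maximalRealSubfield L)) L (IsCMField.complexConj L) 1
              (Matrix.of fun i j : Fin 1 => if i.val + j.val + 1 = 1 then (1 : L) else 0)))) :=
        fun _ => ⟨rfl⟩
      ∃ (m' : OrbitalMeasureFamily (UnitaryGroup.arch (↥(maximalRealSubfield L)) L (IsCMField.complexConj L) 3 H'))
        (m : OrbitalMeasureFamily (UnitaryGroup.arch (↥(maximalRealSubfield L)) L (IsCMField.complexConj L) 3
          (Matrix.of fun i j : Fin 3 => if i.val + j.val + 1 = 3 then (1 : L) else 0)))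
        (mH : OrbitalMeasureFamily (UnitaryGroup.arch (↥(maximalRealSubfield L)) L (IsCMField.complexConj L) 2
            (Matrix.of fun i j : Fin 2 => if i.val + j.val + 1 = 2 then (1 : L) else 0) ×
          UnitaryGroup.arch (↥(maximalRealSubfield L)) L (IsCMField.complexConj L) 1
            (Matrix.of fun i j : Fin 1 => if i.val + j.val + 1 = 1 then (1 : L) else 0)))
        (t' : ∀ γ' : UnitaryGroup.arch (↥(maximalRealSubfield L)) L (IsCMField.complexConj L) 3 H',
          Measure (Subgroup.centralizer ({γ'} : Set (UnitaryGroup.arch (↥(maximalRealSubfield L)) L (IsCMField.complexConj L) 3 H'))))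
        (t : ∀ γ : UnitaryGroup.arch (↥(maximalRealSubfield L)) L (IsCMField.complexConj L) 3
            (Matrix.of fun i j : Fin 3 => if i.val + j.val + 1 = 3 then (1 : L) else 0),
          Measure (Subgroup.centralizer ({γ} : Set (UnitaryGroup.arch (↥(maximalRealSubfield L)) L (IsCMField.complexConj L) 3
            (Matrix.of fun i j : Fin 3 => if i.val + j.val + 1 = 3 then (1 : L) else 0)))))
        (tH : ∀ γH : UnitaryGroup.arch (↥(maximalRealSubfield L)) L (IsCMField.complexConj L) 2
              (Matrix.of fun i j : Fin 2 => if i.val + j.val + 1 = 2 then (1 : L) else 0) ×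
            UnitaryGroup.arch (↥(maximalRealSubfield L)) L (IsCMField.complexConj L) 1
              (Matrix.of fun i j : Fin 1 => if i.val + j.val + 1 = 1 then (1 : L) else 0),
          Measure (Subgroup.centralizer ({γH} : Set (UnitaryGroup.arch (↥(maximalRealSubfield L)) L (IsCMField.complexConj L) 2
              (Matrix.of fun i j : Fin 2 => if i.val + j.val + 1 = 2 then (1 : L) else 0) ×
            UnitaryGroup.arch (↥(maximalRealSubfield L)) L (IsCMField.complexConj L) 1
              (Matrix.of fun i j : Fin 1 => if i.val + j.val + 1 = 1 then (1 : L) else 0))))),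
        ArchCompatibleFamiliesG L H' ν' ν hanis m' m t' t ∧ ArchCompatibleFamiliesH L νH mH tH t)
    (hND : (H'.map (cmConjRingHom L)).transpose = H' → (∀ x : Fin 3 → L, hermForm (cmConjRingHom L) H' x x = 0 → x = 0) → IsArchNondegenerate L H' T)
    (hN2 : ArchInnerTransferCompatible L H' ν' ν) (hN3 : ArchEndoscopicTransferCompatible L H' T ν' ν νH) :
    ArchTransfersExistCanonical L H' T ν' ν νH := by
  intro hherm hanis
  obtain ⟨m', m, mH, t', t, tH, hG, hH⟩ := hM hherm hanis
  exact ⟨m', m, mH, t', t, tH, hG.isAdmissibleOn_inner, hG.isAdmissibleOn_quasiSplit, hH.isAdmissibleOn, hND hherm hanis,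
    hN2 hherm hanis m' m t' t hG, hN3 hherm hanis m' m mH t' t tH hG hH, hG.1, hG.2.1, hH.1, hG.2.2.1, hG.2.2.2.1, hG.2.2.2.2, hH.2⟩

variable (L H' T ν' ν νH)

/-- **The letter #77 at the stubs of THIS file** — what closes when (M) closes, GIVEN the `T`-clauses (ND) and N3 as hypotheses (they become closed stubs the hour
N1, the explicit archimedean factor, is a definition and the line is instantiated at it) and the letter N2 by name.  Axioms: TRIO + `sorryAx` from exactly the two
`sorry` stubs. [cite: Rogawski1990, §14.2 (14.2.1) pp. 232–233; §14.3 pp. 233–234] -/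
theorem archTransfersExistCanonical_holds
    (hND : (H'.map (cmConjRingHom L)).transpose = H' → (∀ x : Fin 3 → L, hermForm (cmConjRingHom L) H' x x = 0 → x = 0) → IsArchNondegenerate L H' T)
    (hN3 : ArchEndoscopicTransferCompatible L H' T ν' ν νH) :
    ArchTransfersExistCanonical L H' T ν' ν νH :=
  archTransfersExistCanonical_of_stubs (fun hherm hanis => stub_archCompatibleFamilies_exists L H' ν' ν νH hherm hanis) hND
    (stub_archInnerTransferCompatible L H' ν' ν) hN3


/-! ## §1b (v2) The stubs AT PRINT'S FACTOR `Δ″_∞` (twin's ★ N1a), under the μ-guard of the endoscopic datum -/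

section Explicit

variable (μ : HeckeCharacter L) (hμu : μ.IsUnitary)
  (hμω : ∀ x : ideleGroup ↥(maximalRealSubfield L), μ (AdeleRing.ideleBaseChange (↥(maximalRealSubfield L)) L x) = quadraticHeckeCharCM L x)
  (hl : ∀ (a : ↥(UnitaryGroup.arch (↥(maximalRealSubfield L)) L (IsCMField.complexConj L) 2
          (Matrix.of fun i j : Fin 2 => if i.val + j.val + 1 = 2 then (1 : L) else 0)) ×
        ↥(UnitaryGroup.arch (↥(maximalRealSubfield L)) L (IsCMField.complexConj L) 1
          (Matrix.of fun i j : Fin 1 => if i.val + j.val + 1 = 1 then (1 : L) else 0)))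
      (b : ↥(UnitaryGroup.arch (↥(maximalRealSubfield L)) L (IsCMField.complexConj L) 3 H'))
      (x : ↥(UnitaryGroup.arch (↥(maximalRealSubfield L)) L (IsCMField.complexConj L) 2
          (Matrix.of fun i j : Fin 2 => if i.val + j.val + 1 = 2 then (1 : L) else 0)) ×
        ↥(UnitaryGroup.arch (↥(maximalRealSubfield L)) L (IsCMField.complexConj L) 1
          (Matrix.of fun i j : Fin 1 => if i.val + j.val + 1 = 1 then (1 : L) else 0))),
      archExplicitDelta L H' (x * a * x⁻¹) μ b = archExplicitDelta L H' a μ b)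
  (hr : ∀ (a : ↥(UnitaryGroup.arch (↥(maximalRealSubfield L)) L (IsCMField.complexConj L) 2
          (Matrix.of fun i j : Fin 2 => if i.val + j.val + 1 = 2 then (1 : L) else 0)) ×
        ↥(UnitaryGroup.arch (↥(maximalRealSubfield L)) L (IsCMField.complexConj L) 1
          (Matrix.of fun i j : Fin 1 => if i.val + j.val + 1 = 1 then (1 : L) else 0)))
      (b y : ↥(UnitaryGroup.arch (↥(maximalRealSubfield L)) L (IsCMField.complexConj L) 3 H')),
      archExplicitDelta L H' a μ (y * b * y⁻¹) = archExplicitDelta L H' a μ b)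

omit
    [MeasurableSpace (UnitaryGroup.arch (↥(maximalRealSubfield L)) L (IsCMField.complexConj L) 3 H')]
    [BorelSpace (UnitaryGroup.arch (↥(maximalRealSubfield L)) L (IsCMField.complexConj L) 3 H')]
    [MeasurableSpace (UnitaryGroup.arch (↥(maximalRealSubfield L)) L (IsCMField.complexConj L) 3
      (Matrix.of fun i j : Fin 3 => if i.val + j.val + 1 = 3 then (1 : L) else 0))]
    [BorelSpace (UnitaryGroup.arch (↥(maximalRealSubfield L)) L (IsCMField.complexConj L) 3
      (Matrix.of fun i j : Fin 3 => if i.val + j.val + 1 = 3 then (1 : L) else 0))]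
    [MeasurableSpace (UnitaryGroup.arch (↥(maximalRealSubfield L)) L (IsCMField.complexConj L) 2
            (Matrix.of fun i j : Fin 2 => if i.val + j.val + 1 = 2 then (1 : L) else 0) ×
          UnitaryGroup.arch (↥(maximalRealSubfield L)) L (IsCMField.complexConj L) 1
            (Matrix.of fun i j : Fin 1 => if i.val + j.val + 1 = 1 then (1 : L) else 0))]
    [BorelSpace (UnitaryGroup.arch (↥(maximalRealSubfield L)) L (IsCMField.complexConj L) 2
            (Matrix.of fun i j : Fin 2 => if i.val + j.val + 1 = 2 then (1 : L) else 0) ×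
          UnitaryGroup.arch (↥(maximalRealSubfield L)) L (IsCMField.complexConj L) 1
            (Matrix.of fun i j : Fin 1 => if i.val + j.val + 1 = 1 then (1 : L) else 0))] in
/-- **STUB (N2∞) — PAYABLE-NOW after N1a-r (S∕M): print's archimedean factor `Δ″_∞` is NON-DEGENERATE on the matching `G`-regular pairs** (`|τ| = 1` for unitary
`μ` at unit arguments, `D_{G∕H,∞} ≠ 0` on the `G`-regular set, `κ = ±1`; §4.9 p. 55).  Guard = the engine's frame + the endoscopic character `μ` (unitary, `μ|_{𝕀_{L⁺}} =
ω_{L∕L⁺}`, §4.8 p. 51). [cite: Rogawski1990, §4.9 pp. 54–55; §14.6 p. 242] -/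
theorem stub_explicitFactor_nondegenerate (hherm : (H'.map (cmConjRingHom L)).transpose = H')
    (hanis : ∀ x : Fin 3 → L, hermForm (cmConjRingHom L) H' x x = 0 → x = 0) :
    IsArchNondegenerate L H' (archExplicitTransferFactor L H' μ hl hr) :=
  Literature.NumberTheory.Rogawski1990.isArchNondegenerate_archExplicitTransferFactor L H' μ hl hr hherm hanis

include hμu hμω in
/-- **STUB (N3 at `Δ″_∞`) — LETTER, CITED (twin's N9 instantiated at print's factor; closed statement): the archimedean endoscopic transfer exists on `C_c^∞` for
every compatible Weil-form system RELATIVE TO `Δ″_∞`** (= ★ p826679 `ArchEndoscopicTransferCompatible L H′ (archExplicitTransferFactor L H′ μ hl hr) ν′ ν νH`), for the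
endoscopic character `μ` (unitary, `μ|_{𝕀_{L⁺}} = ω_{L∕L⁺}`).  Print-true: `Δ′_∞ = c_∞ Δ″_∞` (§14.6 p. 242) and transfers for `Δ′_∞` [§14.3 p. 234; Prop. 4.9.1 (a) p. 55;
Shelstad1982∕1983; ClozelDelorme1984] rescale to `Δ″_∞`. [cite: Rogawski1990, §14.3 pp. 233–234; §4.9 Prop. 4.9.1 (a) p. 55; §14.6 p. 242] [cite: Shelstad1982]
[cite: Shelstad1983] [cite: ClozelDelorme1984, Thm. 1] [cite: ArthurClozel1989, Ch. 1 §7 Lemma 7.3 (i)] -/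
theorem stub_archEndoscopicTransferCompatible_explicit :
    ArchEndoscopicTransferCompatible L H' (archExplicitTransferFactor L H' μ hl hr) ν' ν νH := by
  sorry

end Explicit

/-! ## §1c (v2) RAY TRANSPORT — PROVED: the two `T`-clauses pass from `T₀` to every `T` with `T.Δ = c · T₀.Δ`, `c ≠ 0` (node R of T6a-TREE §2) -/

variable {L H' T ν' ν νH}

/-- **(R-tr) The endoscopic-transfer letter along the ray**: if `a′ ↦ a^H` relative to `T₀` then `a′ ↦ c • a^H` relative to `T` with `T.Δ = c · T₀.Δ` (★
`stableOrbitalIntegralRel_smul_fun`, Mathlib `mul_finsum`; `C_c^∞(H_∞)` is closed under scalars — ★ `archSmooth` is a submodule). [cite: Rogawski1990, §14.6 p. 242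
«Δ′_v = c_v Δ″_v»; §14.3 pp. 233–234] -/
theorem archEndoscopicTransferCompatible_of_ray {T₀ : ArchTransferFactor L H'} {c : ℂ} (hT : ∀ a b, T.Δ a b = c * T₀.Δ a b)
    (h₀ : ArchEndoscopicTransferCompatible L H' T₀ ν' ν νH) : ArchEndoscopicTransferCompatible L H' T ν' ν νH := by
  intro hherm hanis m' m mH t' t tH hG hH a' ha'
  obtain ⟨aH, haH, htr⟩ := h₀ hherm hanis m' m mH t' t tH hG hH a' ha'
  refine ⟨c • aH, ?_, ?_⟩
  · obtain ⟨φ, hφc, hφs, hφsm, hφ⟩ := haH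
    refine ⟨c • φ, hφc.const_smul c, hφs.mono (Function.support_const_smul_subset c φ),
      (mem_archSmooth_iff _ _).1 (Submodule.smul_mem _ c ((mem_archSmooth_iff _ _).2 hφsm)), fun k => ?_⟩
    simp only [Pi.smul_apply, hφ k]
  · -- the `H_∞` orbit-quotient σ-algebras are `borel` (fixed inside the letters); make them the local instances before rewriting (T6a-TREE §4 (T))
    letI : ∀ a : (UnitaryGroup.arch (↥(maximalRealSubfield L)) L (IsCMField.complexConj L) 2 (Matrix.of fun i j : Fin 2 => if i.val + j.val + 1 = 2 then (1 : L) else 0) × UnitaryGroup.arch (↥(maximalRealSubfield L)) L (IsCMField.complexConj L) 1 (Matrix.of fun i j : Fin 1 => if i.val + j.val + 1 = 1 then (1 : L) else 0)),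
        MeasurableSpace ((UnitaryGroup.arch (↥(maximalRealSubfield L)) L (IsCMField.complexConj L) 2 (Matrix.of fun i j : Fin 2 => if i.val + j.val + 1 = 2 then (1 : L) else 0) × UnitaryGroup.arch (↥(maximalRealSubfield L)) L (IsCMField.complexConj L) 1 (Matrix.of fun i j : Fin 1 => if i.val + j.val + 1 = 1 then (1 : L) else 0)) ⧸ Subgroup.centralizer ({a} : Set (UnitaryGroup.arch (↥(maximalRealSubfield L)) L (IsCMField.complexConj L) 2 (Matrix.of fun i j : Fin 2 => if i.val + j.val + 1 = 2 then (1 : L) else 0) × UnitaryGroup.arch (↥(maximalRealSubfield L)) L (IsCMField.complexConj L) 1 (Matrix.of fun i j : Fin 1 => if i.val + j.val + 1 = 1 then (1 : L) else 0)))) :=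
      fun _ => borel _
    haveI : ∀ a : (UnitaryGroup.arch (↥(maximalRealSubfield L)) L (IsCMField.complexConj L) 2 (Matrix.of fun i j : Fin 2 => if i.val + j.val + 1 = 2 then (1 : L) else 0) × UnitaryGroup.arch (↥(maximalRealSubfield L)) L (IsCMField.complexConj L) 1 (Matrix.of fun i j : Fin 1 => if i.val + j.val + 1 = 1 then (1 : L) else 0)),
        BorelSpace ((UnitaryGroup.arch (↥(maximalRealSubfield L)) L (IsCMField.complexConj L) 2 (Matrix.of fun i j : Fin 2 => if i.val + j.val + 1 = 2 then (1 : L) else 0) × UnitaryGroup.arch (↥(maximalRealSubfield L)) L (IsCMField.complexConj L) 1 (Matrix.of fun i j : Fin 1 => if i.val + j.val + 1 = 1 then (1 : L) else 0)) ⧸ Subgroup.centralizer ({a} : Set (UnitaryGroup.arch (↥(maximalRealSubfield L)) L (IsCMField.complexConj L) 2 (Matrix.of fun i j : Fin 2 => if i.val + j.val + 1 = 2 then (1 : L) else 0) × UnitaryGroup.arch (↥(maximalRealSubfield L)) L (IsCMField.complexConj L) 1 (Matrix.of fun i j : Fin 1 => if i.val + j.val + 1 = 1 then (1 : L) else 0))))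 :=
      fun _ => ⟨rfl⟩
    intro γH hγ
    rw [stableOrbitalIntegralRel_smul_fun, htr γH hγ, mul_finsum]
    refine finsum_congr fun c' => ?_
    rw [hT]
    ring

/-! ## §2b (v2) The RAY HEAD — the frame of LEAD WORD T6b-1 (2): Haar binders + `T` on print's ray `ℂ^× · Δ″_∞` -/

section RayHead

variable (L H' T ν' ν νH)
variable (μ : HeckeCharacter L) (hμu : μ.IsUnitary)
  (hμω : ∀ x : ideleGroup ↥(maximalRealSubfield L), μ (AdeleRing.ideleBaseChange (↥(maximalRealSubfield L)) L x) = quadraticHeckeCharCM L x)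
  (hl : ∀ (a : ↥(UnitaryGroup.arch (↥(maximalRealSubfield L)) L (IsCMField.complexConj L) 2
          (Matrix.of fun i j : Fin 2 => if i.val + j.val + 1 = 2 then (1 : L) else 0)) ×
        ↥(UnitaryGroup.arch (↥(maximalRealSubfield L)) L (IsCMField.complexConj L) 1
          (Matrix.of fun i j : Fin 1 => if i.val + j.val + 1 = 1 then (1 : L) else 0)))
      (b : ↥(UnitaryGroup.arch (↥(maximalRealSubfield L)) L (IsCMField.complexConj L) 3 H'))
      (x : ↥(UnitaryGroup.arch (↥(maximalRealSubfield L)) L (IsCMField.complexConj L) 2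
          (Matrix.of fun i j : Fin 2 => if i.val + j.val + 1 = 2 then (1 : L) else 0)) ×
        ↥(UnitaryGroup.arch (↥(maximalRealSubfield L)) L (IsCMField.complexConj L) 1
          (Matrix.of fun i j : Fin 1 => if i.val + j.val + 1 = 1 then (1 : L) else 0))),
      archExplicitDelta L H' (x * a * x⁻¹) μ b = archExplicitDelta L H' a μ b)
  (hr : ∀ (a : ↥(UnitaryGroup.arch (↥(maximalRealSubfield L)) L (IsCMField.complexConj L) 2
          (Matrix.of fun i j : Fin 2 => if i.val + j.val + 1 = 2 then (1 : L) else 0)) ×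
        ↥(UnitaryGroup.arch (↥(maximalRealSubfield L)) L (IsCMField.complexConj L) 1
          (Matrix.of fun i j : Fin 1 => if i.val + j.val + 1 = 1 then (1 : L) else 0)))
      (b y : ↥(UnitaryGroup.arch (↥(maximalRealSubfield L)) L (IsCMField.complexConj L) 3 H')),
      archExplicitDelta L H' a μ (y * b * y⁻¹) = archExplicitDelta L H' a μ b)

include hμu hμω in
/-- **RAY HEAD — #77 for every archimedean factor on print's ray `T.Δ = c · Δ″_∞.Δ`, `c ≠ 0`** (the registrar's frame (ii)), from the four stubs (M), (N2), (N2∞),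
(N3 at `Δ″_∞`) and the proved ray transport §1c.  Axioms: TRIO + `sorryAx` from exactly the four stubs. [cite: Rogawski1990, §14.2 (14.2.1) pp. 232–233; §14.3
pp. 233–234; §14.6 p. 242; §1.7 p. 6] -/
theorem archTransfersExistCanonical_holds_ray (hherm : (H'.map (cmConjRingHom L)).transpose = H')
    (hanis : ∀ x : Fin 3 → L, hermForm (cmConjRingHom L) H' x x = 0 → x = 0)
    (c : ℂ) (hc : c ≠ 0) (hT : ∀ a b, T.Δ a b = c * (archExplicitTransferFactor L H' μ hl hr).Δ a b) :
    ArchTransfersExistCanonical L H' T ν' ν νH :=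
  archTransfersExistCanonical_of_stubs (fun hherm hanis => stub_archCompatibleFamilies_exists L H' ν' ν νH hherm hanis)
    (fun _ _ => isArchNondegenerate_of_ray hc hT (stub_explicitFactor_nondegenerate L H' μ hl hr hherm hanis))
    (stub_archInnerTransferCompatible L H' ν' ν)
    (archEndoscopicTransferCompatible_of_ray hT (stub_archEndoscopicTransferCompatible_explicit L H' ν' ν νH μ hμu hμω hl hr))

end RayHead

/-! ## §3 The closed form for a registry (all frames at once; `T`-clauses as antecedents until N1 lands) -/

/-- **Closed registry form**: for every CM field `L`, hermitian anisotropic frame `H′`, archimedean factor `T` that is NON-DEGENERATE and ADMITS ENDOSCOPIC TRANSFER for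
compatible systems (letter N3), and Haar measures `ν′, ν, νH` (Borel structures quantified), ★ #77 `ArchTransfersExistCanonical L H′ T ν′ ν νH` holds.
[cite: Rogawski1990, §14.2 (14.2.1) pp. 232–233; §14.3 pp. 233–234; §1.7 p. 6] -/
def ArchTransfersExistCanonicalClosed : Prop :=
  ∀ (L : Type) [Field L] [NumberField L] [IsCMField L] (H' : Matrix (Fin 3) (Fin 3) L) (T : ArchTransferFactor L H')
    [MeasurableSpace (UnitaryGroup.arch (↥(maximalRealSubfield L)) L (IsCMField.complexConj L) 3 H')]
    [BorelSpace (UnitaryGroup.arch (↥(maximalRealSubfield L)) L (IsCMField.complexConj L) 3 H')]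
    [MeasurableSpace (UnitaryGroup.arch (↥(maximalRealSubfield L)) L (IsCMField.complexConj L) 3
      (Matrix.of fun i j : Fin 3 => if i.val + j.val + 1 = 3 then (1 : L) else 0))]
    [BorelSpace (UnitaryGroup.arch (↥(maximalRealSubfield L)) L (IsCMField.complexConj L) 3
      (Matrix.of fun i j : Fin 3 => if i.val + j.val + 1 = 3 then (1 : L) else 0))]
    [MeasurableSpace (UnitaryGroup.arch (↥(maximalRealSubfield L)) L (IsCMField.complexConj L) 2
            (Matrix.of fun i j : Fin 2 => if i.val + j.val + 1 = 2 then (1 : L) else 0) ×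
          UnitaryGroup.arch (↥(maximalRealSubfield L)) L (IsCMField.complexConj L) 1
            (Matrix.of fun i j : Fin 1 => if i.val + j.val + 1 = 1 then (1 : L) else 0))]
    [BorelSpace (UnitaryGroup.arch (↥(maximalRealSubfield L)) L (IsCMField.complexConj L) 2
            (Matrix.of fun i j : Fin 2 => if i.val + j.val + 1 = 2 then (1 : L) else 0) ×
          UnitaryGroup.arch (↥(maximalRealSubfield L)) L (IsCMField.complexConj L) 1
            (Matrix.of fun i j : Fin 1 => if i.val + j.val + 1 = 1 then (1 : L) else 0))]
    (ν' : Measure (UnitaryGroup.arch (↥(maximalRealSubfield L)) L (IsCMField.complexConj L) 3 H'))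
    (ν : Measure (UnitaryGroup.arch (↥(maximalRealSubfield L)) L (IsCMField.complexConj L) 3
      (Matrix.of fun i j : Fin 3 => if i.val + j.val + 1 = 3 then (1 : L) else 0)))
    (νH : Measure (UnitaryGroup.arch (↥(maximalRealSubfield L)) L (IsCMField.complexConj L) 2
            (Matrix.of fun i j : Fin 2 => if i.val + j.val + 1 = 2 then (1 : L) else 0) ×
          UnitaryGroup.arch (↥(maximalRealSubfield L)) L (IsCMField.complexConj L) 1
            (Matrix.of fun i j : Fin 1 => if i.val + j.val + 1 = 1 then (1 : L) else 0)))
    [ν'.IsHaarMeasure] [ν'.IsMulRightInvariant] [ν.IsHaarMeasure] [ν.IsMulRightInvariant] [νH.IsHaarMeasure] [νH.IsMulRightInvariant],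
    ((H'.map (cmConjRingHom L)).transpose = H' → (∀ x : Fin 3 → L, hermForm (cmConjRingHom L) H' x x = 0 → x = 0) → IsArchNondegenerate L H' T) →
    ArchEndoscopicTransferCompatible L H' T ν' ν νH →
      ArchTransfersExistCanonical L H' T ν' ν νH

/-- **Head for a registry**: the closed form at the stubs of this file. [cite: Rogawski1990, §14.2 (14.2.1) pp. 232–233; §14.3 pp. 233–234] -/
theorem archTransfersExistCanonical_closed : ArchTransfersExistCanonicalClosed :=
  fun L _ _ _ H' T _ _ _ _ _ _ ν' ν νH _ _ _ _ _ _ hND hN3 => archTransfersExistCanonical_holds L H' T ν' ν νH hND hN3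

end Summit.HodgeConjecture.HodgeConjecture.Cruxes.H413.F0P3aArchTransfersCanonicalPaydown

end
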